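import Literature.NumberTheory.Automorphic.BrandtGrossPoints
import Literature.NumberTheory.Automorphic.BrandtSetupAtkinLehnerInvolutions
import HarnessLib

/-!
# The Frobenius reflection `ρ = τ_c ∘ σ_q` on Gross points of a Brandt set-up: precomposition with an automorphism of `K`
# and right multiplication by the ramified prime `𝔓_q`

[tag: quaternion_algebra] [tag: eichler_order] [tag: heegner_point]

Topic `NumberTheory/Automorphic`.  One definition with a body (`Brandt.grossReflect`) and theorems, all proved; no named fact, no
instance, no `sorry`.  DEFINITION REQUEST of cell `bsd-f1-sign2`, planner seat `-an` g25 (MEMO-an §28.10 (a), 2026-08-29T18:40Z: «-ty: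
the reflection ρ = τσ over `Brandt.IsGrossPoint` (right-multiplication by 𝔓_N on `rightIdeals`, `ψ ∘ conj`), first stub
`stub_toricPeriod_mod_two_eq_sum_fixedPoints`»), for the T1 line («genus vanishing of the toric period», `ToricPeriodGenusVanishing`
of the crux workfile `Cruxes/RankOneAtTwoBigImageOddLocal/DefiniteMod2WaldspurgerAN43.lean`, MEMO-an §28.4) of crux
`stmt-BirchSwinnertonDyer-23715`.  Typer `-ty` g20.

SETTING (vocabulary of `BrandtGrossPoints.lean` / `BrandtXi.lean` / `BrandtSetupAtkinLehnerInvolutions.lean`).  `S : Brandt.XiSetup N⁺ N⁻` a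
Brandt set-up (definite quaternion algebra `S.D` of discriminant `N⁻`, Eichler order `S.O` of level `N⁺`), `q ∣ N⁻` a ramified prime with
its two-sided prime `𝔓_q = normPrimeIdeal S.O q` (`I 𝔓_q ∈ rightIdeals`, `I 𝔓_q 𝔓_q = q I`; the class-set involution
`S.wMinus q hq : [I] ↦ [I 𝔓_q]`), `K` a number field, `c : K ≃ₐ[ℚ] K` (in the application: the non-trivial automorphism of an
imaginary quadratic `K`, complex conjugation), `(ψ, I)` a Gross point of conductor `1` (`Brandt.IsGrossPoint S.O ψ I`).
MEMO-an §28.4: «Two involutions of the Gross set: `τ(ψ, I) = (ψ ∘ c, I)` (precompose with complex conjugation; preserves `[I]`,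
swaps the two orbits = orientations at `N`) and `σ(ψ, I) = (ψ, I·𝔓_N)` (`𝔓_N` the two-sided prime over `N`; commutes with `Pic`,
preserves the left order hence the orbit; `φ ∘ σ = ε φ`).  Then `ρ := τσ` …».

CONTENTS (all PROVED):
* §1 `τ_c` — `IsGrossPoint.comp_algEquiv`: `(ψ ∘ c, I)` is a Gross point (a `ℚ`-automorphism preserves `𝓞_K`, so optimality of
  `ψ|_{𝓞_K}` into `O_L(I)` transports); `grossTranslate_comp_algEquiv`: `(ψ ∘ c)(J) I = ψ(c J) I` — the `Pic`-action is
  TWISTED by `c` under `τ_c` (for complex conjugation on an imaginary quadratic field, `c J = J̄` has class `[J]⁻¹`, whence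
  §28.4's «`ρ(𝔞 ⋆ x) = 𝔞̄ ⋆ ρ(x)`»; on classes: `IsGrossPoint.act_comp_algEquiv` `[J]·[(ψ ∘ c, I)] = [c̃ J]·[(ψ, I)]`; the
  identification `[c̃ J] = [J]⁻¹` for complex conjugation is left to the consumer).
* §2 `σ_q` — `IsGrossPoint.mul_normPrimeIdeal`: `(ψ, I 𝔓_q)` is a Gross point (`I 𝔓_q` is an invertible right ideal and
  `O_L(I 𝔓_q) = O_L(I)` since `I 𝔓_q 𝔓_q = q I`); `grossTranslate_mul`: `ψ(J)(I T) = (ψ(J) I) T`; **`IsGrossPoint.act_mul_normPrimeIdeal`**: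
  `[𝔞]·[(ψ, I 𝔓_q)] = W_{q⁻}([𝔞]·[(ψ, I)])` — `σ_q` COMMUTES with the `Pic(𝓞_K)`-action and acts on classes as the Atkin–Lehner
  involution; **`IsGrossPoint.toricPeriod_mul_normPrimeIdeal`**: `toricPeriod S.O ψ (I 𝔓_q) φ = toricPeriod S.O ψ I (φ ∘ W_{q⁻})` — so for
  a `W_{q⁻}`-eigenvector `φ ∘ W_{q⁻} = ε φ` the period changes by `ε` (`toricPeriod_mul_normPrimeIdeal_of_eigen`).
* §3 `ρ` — `Brandt.grossReflect S q c : (K →ₐ[ℚ] S.D) × Submodule ℤ S.D → …`, `(ψ, I) ↦ (ψ ∘ c, I 𝔓_q)`; `IsGrossPoint.reflect`;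
  `grossReflect` twice = `(ψ ∘ c², q • I)` (`snd_grossReflect_grossReflect`), i.e. an involution on classes when `c² = 1`
  (`S.wMinus_wMinus`); **`IsGrossPoint.act_reflect`**: `[J]·[ρ(ψ, I)] = W_{q⁻}([c̃ J]·[(ψ, I)])`; the period of the reflected point
  (`IsGrossPoint.toricPeriod_reflect`).
WHAT IS NOT HERE (the T1 line's own work, MEMO-an §28.4): the identification of the orbit class `𝔟₀` with `ρ(x₀) ∼ 𝔟₀ ⋆ x₀`
(Skolem–Noether conjugation `ψ ∘ c = Ad(b) ∘ ψ` with `b` anticommuting with `ψ(K)`, `nrd(b I 𝔓_N) = −βN·nrd(I)`), the genus of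
`𝔟₀`, the fixed-point count `#Fix(ρ) = 2^{ω(d)−1}·[𝔟₀ ∈ Pic²]`, and the first stub «`M_w(Y) ≡ Σ_{x ∈ Fix ρ} (wφ)(x) (mod 2)`»; also
the `τ`-invariance of the toric period (re-indexing `Σ_𝔞` by `c_*` on `ClassGroup (𝓞 K)`), which needs the functoriality of
`ClassGroup` under `c` — not used below.

References: Gross 1987 §3 (special points, the `Pic(𝒪)`-action, the involutions at the ramified place); Bertolini–Darmon 1996 §1.5
(`W_{l⁻}`); Vatsal 2004 §6.1, §7.1; Vignéras LNM 800 Ch. II §1 Cor. 1.7, Ch. III §5 ex. 5.8 (`𝔓_q`, `I 𝔓 𝔓 = q I`).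
-/

namespace Literature.NumberTheory.Automorphic.Brandt

open scoped NumberField Pointwise nonZeroDivisors
open NumberField

universe u

/-! ## §1 `τ_c`: precomposition with a `ℚ`-automorphism of `K` -/

section Tau

variable {D : Type u} [Ring D] [Algebra ℚ D]
variable {K : Type*} [Field K] [NumberField K]
variable {O I : Submodule ℤ D} {ψ : K →ₐ[ℚ] D}

/-- A `ℚ`-algebra automorphism of a number field maps integers to integers: `c(𝓞_K) ⊆ 𝓞_K`, i.e. `c` preserves the range of
`algebraMap (𝓞 K) K` (via `NumberField.RingOfIntegers.mapRingEquiv`). [folklore] -/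
private theorem algEquiv_mem_range_algebraMap_ringOfIntegers (c : K ≃ₐ[ℚ] K) {x : K}
    (hx : x ∈ (algebraMap (𝓞 K) K).range) : c x ∈ (algebraMap (𝓞 K) K).range := by
  obtain ⟨y, rfl⟩ := hx
  exact ⟨RingOfIntegers.mapRingEquiv (c : K ≃+* K) y, rfl⟩

/-- **`τ_c` preserves Gross points**: for a Gross point `(ψ, I)` of conductor `1` and any `ℚ`-automorphism `c` of `K`,
`(ψ ∘ c, I)` is again a Gross point of conductor `1` — same right ideal, same left order, and `ψ ∘ c` embeds `𝓞_K = c(𝓞_K)`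
optimally (Gross 1987 §3: the involution exchanging the two orientations; MEMO-an §28.4 `τ`). [cite: Gross1987, §3] -/
theorem IsGrossPoint.comp_algEquiv (h : IsGrossPoint O ψ I) (c : K ≃ₐ[ℚ] K) :
    IsGrossPoint O (ψ.comp (c : K →ₐ[ℚ] K)) I where
  mem_rightIdeals := h.mem_rightIdeals
  map_mem_leftOrder x := by
    obtain ⟨y, hy⟩ := algEquiv_mem_range_algebraMap_ringOfIntegers c (x := (x : K)) ⟨x, rfl⟩
    show ψ (c (x : K)) ∈ leftOrder I
    rw [← hy]
    exact h.map_mem_leftOrder y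
  mem_range_of_map_mem_leftOrder x hx := by
    have hcx : c x ∈ (algebraMap (𝓞 K) K).range := h.mem_range_of_map_mem_leftOrder (c x) hx
    simpa using algEquiv_mem_range_algebraMap_ringOfIntegers c.symm hcx

/-- The translate along `ψ ∘ c` unfolded: `(ψ ∘ c)(J) I = ℤ⟨ψ(c(J))⟩ I` (Gross's action `J · (ψ, I) = (ψ, ψ(J) I)` read for the
embedding `ψ ∘ c`). [cite: Gross1987, §3] -/
theorem grossTranslate_comp_algEquiv (ψ : K →ₐ[ℚ] D) (c : K ≃ₐ[ℚ] K) (J : Ideal (𝓞 K)) (I : Submodule ℤ D) :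
    grossTranslate (ψ.comp (c : K →ₐ[ℚ] K)) J I =
      Submodule.span ℤ ((fun x : 𝓞 K => ψ (c (x : K))) '' (J : Set (𝓞 K))) * I :=
  rfl

/-- **The `Pic`-action is twisted by `c` under `τ_c`**: `(ψ ∘ c)(J) I = ψ(c̃ J) I` with `c̃ = RingOfIntegers.mapRingEquiv c` the
restriction of `c` to `𝓞_K` (for complex conjugation on an imaginary quadratic field `c̃ J = J̄`, of class `[J]⁻¹` — MEMO-an §28.4
«`ρ(𝔞 ⋆ x) = 𝔞̄ ⋆ ρ(x)`»). [cite: Gross1987, §3] -/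
theorem grossTranslate_comp_algEquiv_eq_map (ψ : K →ₐ[ℚ] D) (c : K ≃ₐ[ℚ] K) (J : Ideal (𝓞 K)) (I : Submodule ℤ D) :
    grossTranslate (ψ.comp (c : K →ₐ[ℚ] K)) J I =
      grossTranslate ψ (J.map (RingOfIntegers.mapRingEquiv (c : K ≃+* K))) I := by
  rw [grossTranslate_def, grossTranslate_def]
  congr 2
  ext z
  simp only [Set.mem_image, SetLike.mem_coe]
  constructor
  · rintro ⟨x, hx, rfl⟩
    exact ⟨RingOfIntegers.mapRingEquiv (c : K ≃+* K) x, Ideal.mem_map_of_mem _ hx, rfl⟩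
  · rintro ⟨y, hy, rfl⟩
    rw [Ideal.mem_map_iff_of_surjective _ (RingOfIntegers.mapRingEquiv (c : K ≃+* K)).surjective] at hy
    obtain ⟨x, hx, rfl⟩ := hy
    exact ⟨x, hx, rfl⟩

/-- The image of a non-zero ideal of `𝓞_K` under (the restriction of) a `ℚ`-automorphism is non-zero (plumbing for the class
`[c̃ J]`). [folklore] -/
private theorem map_mapRingEquiv_mem_nonZeroDivisors (c : K ≃ₐ[ℚ] K) (J : (Ideal (𝓞 K))⁰) :
    (J : Ideal (𝓞 K)).map (RingOfIntegers.mapRingEquiv (c : K ≃+* K)) ∈ (Ideal (𝓞 K))⁰ := by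
  rw [mem_nonZeroDivisors_iff_ne_zero, ne_eq, Submodule.zero_eq_bot,
    Ideal.map_eq_bot_iff_of_injective (RingOfIntegers.mapRingEquiv (c : K ≃+* K)).injective]
  exact ne_bot_of_mem_nonZeroDivisors J

/-- **`τ_c` twists the `Pic`-action on classes**: `[J]·[(ψ ∘ c, I)] = [c̃ J]·[(ψ, I)]` in `Cls O` (`c̃ = mapRingEquiv c`; for complex
conjugation on an imaginary quadratic `K`, `[c̃ J] = [J]⁻¹`). [cite: Gross1987, §3] -/
theorem IsGrossPoint.act_comp_algEquiv (h : IsGrossPoint O ψ I) (c : K ≃ₐ[ℚ] K) (J : (Ideal (𝓞 K))⁰) :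
    (h.comp_algEquiv c).act (ClassGroup.mk0 J) =
      h.act (ClassGroup.mk0 ⟨_, map_mapRingEquiv_mem_nonZeroDivisors c J⟩) := by
  rw [(h.comp_algEquiv c).act_eq_mk rfl, h.act_eq_mk rfl]
  exact congrArg _ (Subtype.ext (grossTranslate_comp_algEquiv_eq_map ψ c J I))

end Tau

/-! ## §2 `σ_q`: right multiplication by the ramified prime `𝔓_q` -/

section Sigma

variable {Nplus Nminus : ℕ} (S : XiSetup Nplus Nminus)
variable {K : Type*} [Field K] [NumberField K]
variable {I : Submodule ℤ S.D} {ψ : K →ₐ[ℚ] S.D}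

/-- `ψ(J)(I T) = (ψ(J) I) T`: Gross's translation along `ψ` commutes with right multiplication by any lattice `T` (associativity;
the `Pic(𝒪)`-action commutes with the involutions at the ramified places). [cite: Gross1987, §3] -/
theorem grossTranslate_mul {D : Type u} [Ring D] [Algebra ℚ D] (ψ : K →ₐ[ℚ] D) (J : Ideal (𝓞 K)) (I T : Submodule ℤ D) :
    grossTranslate ψ J (I * T) = grossTranslate ψ J I * T :=
  (mul_assoc _ _ _).symm

/-- **`σ_q` preserves Gross points**: for `q ∣ N⁻` and a Gross point `(ψ, I)` of the set-up `S`, `(ψ, I 𝔓_q)` is a Gross point —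
`I 𝔓_q` is an invertible right `O`-ideal (`XiSetup.mul_normPrimeIdeal_mem_of_dvd`) with the SAME left order
(`XiSetup.leftOrder_mul_eq_of_mul_mul`, from `I 𝔓_q 𝔓_q = q I`), so the optimal embedding is untouched (MEMO-an §28.4 `σ`:
«commutes with Pic, preserves the left order hence the orbit»). [cite: VignerasLNM800, Ch. II §1 Cor. 1.7 and Ch. III §5 exercice 5.8 (c)] [cite: BertoliniDarmon1996, §1.5] -/
theorem IsGrossPoint.mul_normPrimeIdeal {q : ℕ} [Fact q.Prime] (hq : q ∣ Nminus) (h : IsGrossPoint S.O ψ I) :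
    IsGrossPoint S.O ψ (I * normPrimeIdeal S.O q) where
  mem_rightIdeals := S.mul_normPrimeIdeal_mem_of_dvd hq h.mem_rightIdeals
  map_mem_leftOrder x := by
    rw [S.leftOrder_mul_eq_of_mul_mul (Fact.out : q.Prime).ne_zero
      (S.mul_normPrimeIdeal_mul_normPrimeIdeal_of_dvd hq h.mem_rightIdeals)]
    exact h.map_mem_leftOrder x
  mem_range_of_map_mem_leftOrder x hx := by
    rw [S.leftOrder_mul_eq_of_mul_mul (Fact.out : q.Prime).ne_zero
      (S.mul_normPrimeIdeal_mul_normPrimeIdeal_of_dvd hq h.mem_rightIdeals)] at hx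
    exact h.mem_range_of_map_mem_leftOrder x hx

/-- **`σ_q` commutes with the `Pic(𝓞_K)`-action and is `W_{q⁻}` on classes**: `[𝔞]·[(ψ, I 𝔓_q)] = W_{q⁻}([𝔞]·[(ψ, I)])` in `Cls O`.
[cite: BertoliniDarmon1996, §1.5] [cite: Gross1987, §3] -/
theorem IsGrossPoint.act_mul_normPrimeIdeal {q : ℕ} [Fact q.Prime] (hq : q ∣ Nminus) (h : IsGrossPoint S.O ψ I)
    (𝔞 : ClassGroup (𝓞 K)) :
    (h.mul_normPrimeIdeal S hq).act 𝔞 = S.wMinus q hq (h.act 𝔞) := by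
  rw [IsGrossPoint.act, IsGrossPoint.act, XiSetup.wMinus_mk]
  exact congrArg _ (Subtype.ext (grossTranslate_mul ψ _ I _))

/-- **The toric period under `σ_q`**: `Σ_𝔞 φ([𝔞]·[(ψ, I 𝔓_q)]) = Σ_𝔞 (φ ∘ W_{q⁻})([𝔞]·[(ψ, I)])`. [cite: Gross1987, §3] [cite: Vatsal2004, Theorem 6.4 and (7-5)] -/
theorem IsGrossPoint.toricPeriod_mul_normPrimeIdeal {R : Type*} [AddCommMonoid R] {q : ℕ} [Fact q.Prime] (hq : q ∣ Nminus)
    (h : IsGrossPoint S.O ψ I) (φ : ClassSet S.O → R) :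
    toricPeriod S.O ψ (I * normPrimeIdeal S.O q) φ = toricPeriod S.O ψ I (φ ∘ S.wMinus q hq) := by
  rw [(h.mul_normPrimeIdeal S hq).toricPeriod_eq, h.toricPeriod_eq]
  exact Finset.sum_congr rfl fun 𝔞 _ => by rw [h.act_mul_normPrimeIdeal S hq 𝔞, Function.comp_apply]

/-- For a `W_{q⁻}`-EIGENVECTOR `φ ∘ W_{q⁻} = ε • φ` the toric period changes by `ε` under `σ_q` (MEMO-an §28.4 «`φ ∘ σ = ε φ`»,
«`(w·φ)(ρx) = ε·(w·φ)(x)`»). [cite: Gross1987, §3] -/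
theorem IsGrossPoint.toricPeriod_mul_normPrimeIdeal_of_eigen {R : Type*} [CommRing R] {q : ℕ} [Fact q.Prime] (hq : q ∣ Nminus)
    (h : IsGrossPoint S.O ψ I) (φ : ClassSet S.O → R) (ε : R) (hφ : ∀ x, φ (S.wMinus q hq x) = ε * φ x) :
    toricPeriod S.O ψ (I * normPrimeIdeal S.O q) φ = ε * toricPeriod S.O ψ I φ := by
  rw [h.toricPeriod_mul_normPrimeIdeal S hq φ, h.toricPeriod_eq, h.toricPeriod_eq, Finset.mul_sum]
  exact Finset.sum_congr rfl fun 𝔞 _ => hφ _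

/-! ## §3 The reflection `ρ = τ_c ∘ σ_q` -/

/-- **The Frobenius reflection on pairs (embedding, lattice)**: `ρ_{c,q}(ψ, I) = (ψ ∘ c, I 𝔓_q)` — MEMO-an §28.4's `ρ = τσ` for the
set-up `S`, the ramified prime `q ∣ N⁻` and an automorphism `c` of `K` (complex conjugation in the application; `τ` and `σ`
commute, acting on different components).  On Gross points of conductor `1` it is again a Gross point (`IsGrossPoint.reflect`).
[cite: Gross1987, §3] [cite: BertoliniDarmon1996, §1.5] -/
def grossReflect (q : ℕ) (c : K ≃ₐ[ℚ] K) (x : (K →ₐ[ℚ] S.D) × Submodule ℤ S.D) :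
    (K →ₐ[ℚ] S.D) × Submodule ℤ S.D :=
  (x.1.comp (c : K →ₐ[ℚ] K), x.2 * normPrimeIdeal S.O q)

/-- First component of `ρ`: the embedding `ψ ∘ c`. [cite: Gross1987, §3] -/
@[simp] theorem grossReflect_fst (q : ℕ) (c : K ≃ₐ[ℚ] K) (x : (K →ₐ[ℚ] S.D) × Submodule ℤ S.D) :
    (grossReflect S q c x).1 = x.1.comp (c : K →ₐ[ℚ] K) := rfl

/-- Second component of `ρ`: the lattice `I 𝔓_q`. [cite: Gross1987, §3] [cite: BertoliniDarmon1996, §1.5] -/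
@[simp] theorem grossReflect_snd (q : ℕ) (c : K ≃ₐ[ℚ] K) (x : (K →ₐ[ℚ] S.D) × Submodule ℤ S.D) :
    (grossReflect S q c x).2 = x.2 * normPrimeIdeal S.O q := rfl

/-- **`ρ` preserves Gross points.** [cite: Gross1987, §3] -/
theorem IsGrossPoint.reflect {q : ℕ} [Fact q.Prime] (hq : q ∣ Nminus) (c : K ≃ₐ[ℚ] K) (h : IsGrossPoint S.O ψ I) :
    IsGrossPoint S.O (grossReflect S q c (ψ, I)).1 (grossReflect S q c (ψ, I)).2 :=
  (h.mul_normPrimeIdeal S hq).comp_algEquiv c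

/-- `ρ` applied twice: the embedding becomes `ψ ∘ c ∘ c` and the lattice `q • I` (`I 𝔓_q 𝔓_q = q I`); so for an involution `c`
(`c.trans c = 1`) `ρ²` fixes the embedding and multiplies the lattice by the central unit `q` — the identity on Gross points up to
`Dˣ` (on classes: `XiSetup.wMinus_wMinus`). [cite: VignerasLNM800, Ch. III §5 exercice 5.8 (c)] -/
theorem snd_grossReflect_grossReflect {q : ℕ} [Fact q.Prime] (hq : q ∣ Nminus) (c : K ≃ₐ[ℚ] K) (hI : I ∈ rightIdeals S.O) :
    (grossReflect S q c (grossReflect S q c (ψ, I))).2 = (q : ℤ) • I := by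
  rw [grossReflect_snd, grossReflect_snd]
  exact S.mul_normPrimeIdeal_mul_normPrimeIdeal_of_dvd hq hI

/-- `ρ` twice on the embedding: `ψ ∘ c ∘ c` (the identity for an involution `c`). [cite: Gross1987, §3] -/
theorem fst_grossReflect_grossReflect (q : ℕ) (c : K ≃ₐ[ℚ] K) :
    (grossReflect S q c (grossReflect S q c (ψ, I))).1 = ψ.comp ((c.trans c : K ≃ₐ[ℚ] K) : K →ₐ[ℚ] K) := by
  rw [grossReflect_fst, grossReflect_fst]
  ext x
  rfl

/-- **The toric period of the reflected point**: `toricPeriod (ψ ∘ c) (I 𝔓_q) φ = toricPeriod (ψ ∘ c) I (φ ∘ W_{q⁻})`; the remaining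
`τ`-invariance `toricPeriod (ψ ∘ c) I = toricPeriod ψ I` (re-indexing the sum over `Pic(𝓞_K)` by `c_*`, a bijection) is left to the
consumer. [cite: Gross1987, §3] [cite: Vatsal2004, Theorem 6.4 and (7-5)] -/
theorem IsGrossPoint.toricPeriod_reflect {R : Type*} [AddCommMonoid R] {q : ℕ} [Fact q.Prime] (hq : q ∣ Nminus)
    (c : K ≃ₐ[ℚ] K) (h : IsGrossPoint S.O ψ I) (φ : ClassSet S.O → R) :
    toricPeriod S.O (grossReflect S q c (ψ, I)).1 (grossReflect S q c (ψ, I)).2 φ =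
      toricPeriod S.O (ψ.comp (c : K →ₐ[ℚ] K)) I (φ ∘ S.wMinus q hq) :=
  (h.comp_algEquiv c).toricPeriod_mul_normPrimeIdeal S hq φ

/-- **`ρ` on classes**: `[J]·[ρ(ψ, I)] = W_{q⁻}([c̃ J]·[(ψ, I)])` — the reflection is «`Pic`-twisted by `c` and composed with the
Atkin–Lehner involution at `q`» (MEMO-an §28.4: `ρ(𝔞 ⋆ x) = 𝔞̄ ⋆ ρ(x)`, with the ramified-prime shift). [cite: Gross1987, §3] [cite: BertoliniDarmon1996, §1.5] -/
theorem IsGrossPoint.act_reflect {q : ℕ} [Fact q.Prime] (hq : q ∣ Nminus) (c : K ≃ₐ[ℚ] K) (h : IsGrossPoint S.O ψ I)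
    (J : (Ideal (𝓞 K))⁰) :
    (h.reflect S hq c).act (ClassGroup.mk0 J) =
      S.wMinus q hq (h.act (ClassGroup.mk0 ⟨_, map_mapRingEquiv_mem_nonZeroDivisors c J⟩)) :=
  ((h.mul_normPrimeIdeal S hq).act_comp_algEquiv c J).trans ((h.act_mul_normPrimeIdeal S hq _))

end Sigma

end Literature.NumberTheory.Automorphic.Brandt
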